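import Summits.BirchSwinnertonDyer.Rank1Residual.GaloisImage.LocalThreeTorsionDecider
import Summits.BirchSwinnertonDyer.Rank1Residual.GaloisImage.LocalThreeTorsionCountAt
import Summits.BirchSwinnertonDyer.Rank1Residual.GaloisImage.PadicSquareClass
import Literature.NumberTheory.EllipticCurves.GlobalMinimalModel
import HarnessLib

/-!
# KERNEL DECIDER for the local `3`-torsion count `#E(ℚ_ℓ)[3]` at every prime `ℓ ≠ 3` from the
# integer `a`-invariants and a `decide`-checked certificate (team n1011, row T-LOC3L, FILE L3 —
# the `ℓ ≠ 3` twin of T-LOC3T FILE C2 `LocalThreeTorsionDecider`)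

HONEST FRAMING (cell `b2b-bsdres`, run/shared/lean/b2b/bsd-rank1-residual/, verbatim in every
file): the goal of the cell is to DELETE the COMBINATION-SHAPED residual classes of the
Birch–Swinnerton-Dyer formula for ALL analytic-rank `≤ 1` elliptic curves over `ℚ` — "full BSD
formula for every rank `≤ 1` curve in class `C`" assembled STRICTLY from published theorems — so
that the rank-`≤ 1` remainder becomes exactly the CONSTRUCTION-SHAPED classes, which are TYPED
(missing-input `Prop`s), NOT attempted. This is not "finishing BSD". Team n1011 (N10/N11): research
route; this file is a TOOL; nothing is booked by it; no mark / label moved; X4 stays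
CONSTRUCTION-SHAPED. THEOREMS + small computable certificate-checker definitions (`Bool`/`Option ℕ`
valued, no mathematical content); no named fact, no `sorry`.

## What

* `threeTorsionCheckAt (p : ℕ) (a₁ a₂ a₃ a₄ a₆ : ℤ) (k : ℕ) (cert : List (ℤ × ℕ × ℕ × ℕ)) : Option ℕ`
  — EXACTLY T-LOC3T's `threeTorsionCheck` with `3 ↦ p`: FILE A's root census `RootCensus.check₂ p`
  of `Ψ₃ = 3X⁴ + b₂X³ + 3b₄X² + 3b₆X + b₈` at precision `k` on the Hensel balls `(cᵢ, mᵢ, Nᵢ)` of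
  `cert`, plus per entry the `g`-data `p^{wᵢ} ∥ g(cᵢ)` (`g = 4X³ + b₂X² + 2b₄X + b₆`) read at
  precision `wᵢ + δ_p + mᵢ ≤ Nᵢ` (`δ_p = sqPrecAt p`: `3` for `p = 2`, `1` otherwise); the value
  `S` = number of entries whose `g(cᵢ) = p^{wᵢ} u` has `wᵢ` even and `u` a square unit
  (`sqFlagAt`: `u ≡ 1 (mod 8)` at `2`, Euler `u^{(p-1)/2} ≡ 1 (mod p)` at odd `p`).
* **`natCard_threeTorsion_padic_eq_of_check`** — for a prime `p ≠ 3`, if the check returns `some S`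
  and `Δ ≠ 0`, then
  `Nat.card {Q : ((⟨a₁,a₂,a₃,a₄,a₆⟩ : WeierstrassCurve ℚ).baseChange ℚ_[p]).toAffine.Point //
  (3 : ℕ) • Q = 0} = 1 + 2 * S`; consumer shapes `…_eq_one_of_check` (`S = 0`: the T-VIS3 binder
  `hloc` at a place `v ∤ 3` / free kind (i) of p04's `sq_dvd_card_sha_three_of_congr_of_places`, via
  p18's `ℚ_[p] ↔ v.adicCompletion ℚ` bridge) and `…_eq_three_of_check` (`S = 1`: the numeral
  `#E(ℚ_w)[3] ≤ 3` of free kind (ii) — split multiplicative at `w ≡ 1 (mod 3)`, where `μ₃ ⊂ ℚ_w` and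
  the filtration test `3 ∤ c_w·#Ẽ_ns(𝔽_w)` cannot apply), and the `integralModelInt` twins.
* Mathematics: FILE L2 (`x`-coordinates of `3`-torsion points over `ℚ_ℓ`, `ℓ ≠ 3`, are `ℓ`-adic
  integers — `Ê(ℓℤ_ℓ)` has no prime-to-`ℓ` torsion), T-LOC3T FILE B's field-generic fibre count
  (`#{y} ∈ {0, 2}` by the square class of `g(x)`), FILE A (the roots of `Ψ₃` in `ℤ_ℓ` are exactly
  the certified Hensel roots `zᵢ ≡ cᵢ (mod ℓ^{Nᵢ-mᵢ})`), and FILE L1 (square class of `g(zᵢ)` read at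
  `cᵢ`: `‖g(zᵢ) - g(cᵢ)‖ ≤ ℓ^{-δ}‖g(cᵢ)‖`; Serre, *Cours d'arithmétique* II §3.3 Thm 3/4).
* Certificates are FOUND outside the kernel (`census/loc3l_cert.py`, seat folder /
  `HOME/b2b-bsdres-n1011-p17/census/`) and CHECKED inside by `decide +kernel`; at `ℓ = 3` use
  T-LOC3T's `threeTorsionCheck` (this file's theorem needs `ℓ ≠ 3` for the integrality step only).

References: [SilvermanAEC2009] Ex. 3.7, VII.3.1; [Serre1973] Ch. II §3.3; Hensel's lemma (Mathlib).
-/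

set_option autoImplicit false

noncomputable section

open scoped Classical
open Polynomial WeierstrassCurve
open Summit.BirchSwinnertonDyer.Rank1Residual.GaloisImage.RootCensus
open Summit.BirchSwinnertonDyer.Rank1Residual.GaloisImage.PadicSquareClass
open Summit.BirchSwinnertonDyer.Rank1Residual.GaloisImage.LocalTorsion3
  (bInvs psi3List gList toRootEntry equation_iff_sq_eq_g natCard_fibre_eq_two natCard_fibre_eq_zero
    finite_fibre)

namespace Summit.BirchSwinnertonDyer.Rank1Residual.GaloisImage.LocalTorsion3At

/-! ### The checker -/

/-- Precision (in powers of `p`) beyond the valuation at which the square class of a non-zero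
`p`-adic number is determined: `3` for `p = 2` (mod `8`), `1` for odd `p`. [folklore] -/
def sqPrecAt (p : ℕ) : ℕ := if p = 2 then 3 else 1

/-- **Square flag** of an integer `n` read as `n = p^w · u`: `w` even, and `u ≡ 1 (mod 8)` if
`p = 2`, resp. `(u mod p)^{p/2} ≡ 1 (mod p)` (Euler) if `p` is odd. [folklore] -/
def sqFlagAt (p : ℕ) (n : ℤ) (w : ℕ) : Bool :=
  (w % 2 == 0) &&
    (if p = 2 then (n / (p : ℤ) ^ w) % 8 == 1
     else (((n / (p : ℤ) ^ w) % (p : ℤ)).toNat ^ (p / 2)) % p == 1)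

/-- Per-entry `g`-data check for `(c, m, N, w)` at `p`: `p^w ∣ g(c)`, `p^{w+1} ∤ g(c)`,
`w + δ_p + m ≤ N`. [folklore] -/
def gEntryOKAt (p : ℕ) (lg : List ℤ) (e : ℤ × ℕ × ℕ × ℕ) : Bool :=
  (evalList lg e.1 % (p : ℤ) ^ e.2.2.2 == 0) && !(evalList lg e.1 % (p : ℤ) ^ (e.2.2.2 + 1) == 0) &&
    decide (e.2.2.2 + sqPrecAt p + e.2.1 ≤ e.2.2.1)

/-- **The checker at `p`.** `some S` iff FILE A's root census (`check₂ p`) of `Ψ₃` succeeds at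
precision `k` on the balls of `cert` and every entry's `g`-data checks; `S` = number of entries
with a square `g`. [folklore] -/
def threeTorsionCheckAt (p : ℕ) (a₁ a₂ a₃ a₄ a₆ : ℤ) (k : ℕ) (cert : List (ℤ × ℕ × ℕ × ℕ)) :
    Option ℕ :=
  if check₂ p (psi3List a₁ a₂ a₃ a₄ a₆) k (cert.map toRootEntry) &&
      cert.all (gEntryOKAt p (gList a₁ a₂ a₃ a₄ a₆))
  then some (cert.countP fun e => sqFlagAt p (evalList (gList a₁ a₂ a₃ a₄ a₆) e.1) e.2.2.2)
  else none

/-! ### Bridging the flags to FILE L1 -/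

/-- `1 ≤ δ_p`. [folklore] -/
theorem one_le_sqPrecAt (p : ℕ) : 1 ≤ sqPrecAt p := by
  unfold sqPrecAt; split_ifs <;> norm_num

/-- `δ_2 = 3`. [folklore] -/
theorem sqPrecAt_eq_three_of_eq_two {p : ℕ} (h : p = 2) : 3 ≤ sqPrecAt p := by
  subst h; unfold sqPrecAt; simp

/-- The flag decides the square class of an integer `n` with `p^w ∥ n` in `ℚ_p` (FILE L1's
`isSquare_intCast_padic_iff`). [cite: Serre1973, Ch. II §3.3 Thm 3, Thm 4] -/
theorem isSquare_intCast_padic_iff_sqFlagAt {p : ℕ} [Fact p.Prime] (n : ℤ) (w : ℕ)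
    (hw : (p : ℤ) ^ w ∣ n) (hw' : ¬ (p : ℤ) ^ (w + 1) ∣ n) :
    IsSquare (n : ℚ_[p]) ↔ sqFlagAt p n w = true := by
  rw [isSquare_intCast_padic_iff n w hw hw']
  by_cases h2 : p = 2
  · subst h2
    simp [sqFlagAt]
  · simp [sqFlagAt, h2]

/-! ### The decider theorem -/

section Main

variable (p : ℕ) [hp : Fact p.Prime] (a₁ a₂ a₃ a₄ a₆ : ℤ)

/-- The curve over `ℚ_p`. -/
private abbrev Ep : WeierstrassCurve ℚ_[p] :=
  ((⟨a₁, a₂, a₃, a₄, a₆⟩ : WeierstrassCurve ℚ).baseChange ℚ_[p])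

/-- The curve over `ℚ_p` has the cast integer coefficients. -/
private theorem Ep_eq : Ep p a₁ a₂ a₃ a₄ a₆ =
    ⟨(a₁ : ℚ_[p]), (a₂ : ℚ_[p]), (a₃ : ℚ_[p]), (a₄ : ℚ_[p]), (a₆ : ℚ_[p])⟩ := by
  ext <;> simp [Ep, WeierstrassCurve.baseChange, WeierstrassCurve.map]

/-- The curve over `ℚ_p` has `p`-integral coefficients. -/
private instance Ep_isIntegral : (Ep p a₁ a₂ a₃ a₄ a₆).IsIntegral ℤ_[p] := by
  rw [Ep_eq]
  exact ⟨⟨(a₁ : ℤ_[p]), (a₂ : ℤ_[p]), (a₃ : ℤ_[p]), (a₄ : ℤ_[p]), (a₆ : ℤ_[p])⟩,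
    by ext <;> simp [WeierstrassCurve.baseChange, WeierstrassCurve.map]⟩

/-- The discriminant over `ℚ_p` is the cast of the integer discriminant. -/
private theorem Ep_Δ : (Ep p a₁ a₂ a₃ a₄ a₆).Δ =
    (((⟨a₁, a₂, a₃, a₄, a₆⟩ : WeierstrassCurve ℤ).Δ : ℤ) : ℚ_[p]) := by
  have : Ep p a₁ a₂ a₃ a₄ a₆ =
      (⟨a₁, a₂, a₃, a₄, a₆⟩ : WeierstrassCurve ℤ).map (Int.castRingHom ℚ_[p]) := by
    rw [Ep_eq]; ext <;> simp [WeierstrassCurve.map]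
  rw [this, WeierstrassCurve.map_Δ]; simp

/-- `Ψ₃` of the curve, evaluated at a `p`-adic integer, is FILE A's integer polynomial. -/
private theorem eval_Ψ₃_eq_aeval (z : ℤ_[p]) :
    (Ep p a₁ a₂ a₃ a₄ a₆).Ψ₃.eval (z : ℚ_[p]) =
      ((aeval z (ofList (psi3List a₁ a₂ a₃ a₄ a₆)) : ℤ_[p]) : ℚ_[p]) := by
  rw [coe_aeval_ofList, Additive.eval_psi3_eq, Ep_eq]
  simp only [psi3List, bInvs, aeval_ofList_cons, aeval_ofList_nil,
    WeierstrassCurve.b₂, WeierstrassCurve.b₄, WeierstrassCurve.b₆, WeierstrassCurve.b₈]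
  push_cast
  ring

/-- `g` of the curve, evaluated at a `p`-adic integer, is the integer polynomial `gList`. -/
private theorem g_eq_aeval (z : ℤ_[p]) :
    4 * (z : ℚ_[p]) ^ 3 + (Ep p a₁ a₂ a₃ a₄ a₆).b₂ * (z : ℚ_[p]) ^ 2 +
        2 * (Ep p a₁ a₂ a₃ a₄ a₆).b₄ * (z : ℚ_[p]) + (Ep p a₁ a₂ a₃ a₄ a₆).b₆ =
      ((aeval z (ofList (gList a₁ a₂ a₃ a₄ a₆)) : ℤ_[p]) : ℚ_[p]) := by
  rw [coe_aeval_ofList, Ep_eq]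
  simp only [gList, bInvs, aeval_ofList_cons, aeval_ofList_nil,
    WeierstrassCurve.b₂, WeierstrassCurve.b₄, WeierstrassCurve.b₆]
  push_cast
  ring

/-- `(l.map f)`-sums over `Fin l.length`. [folklore] -/
private theorem sum_fin_eq_sum_map {α : Type*} (l : List α) (f : α → ℕ) :
    ∑ i : Fin l.length, f (l.get i) = (l.map f).sum := by
  rw [← List.sum_ofFn]
  congr 1
  rw [show (fun i => f (l.get i)) = f ∘ l.get from rfl, ← List.map_ofFn, List.ofFn_get]

/-- `Σ (if b then 2 else 0) = 2 · countP`. [folklore] -/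
private theorem sum_map_ite_eq_two_mul_countP {α : Type*} (l : List α) (P : α → Bool) :
    (l.map fun a => if P a then 2 else 0).sum = 2 * l.countP P := by
  induction l with
  | nil => simp
  | cons a l ih =>
    simp only [List.map_cons, List.sum_cons, ih, List.countP_cons]
    by_cases h : P a <;> simp [h]; ring

/-- **THE DECIDER at `p ≠ 3`.** If `threeTorsionCheckAt p a₁ a₂ a₃ a₄ a₆ k cert = some S` and
`Δ ≠ 0`, then the number of `ℚ_p`-rational points `Q` of
`E : y² + a₁xy + a₃y = x³ + a₂x² + a₄x + a₆` with `3Q = O` is `1 + 2S`. [folklore] -/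
theorem natCard_threeTorsion_padic_eq_of_check (hp3 : p ≠ 3)
    (hΔ : (⟨a₁, a₂, a₃, a₄, a₆⟩ : WeierstrassCurve ℤ).Δ ≠ 0) {k S : ℕ}
    {cert : List (ℤ × ℕ × ℕ × ℕ)} (h : threeTorsionCheckAt p a₁ a₂ a₃ a₄ a₆ k cert = some S) :
    Nat.card {Q : ((⟨a₁, a₂, a₃, a₄, a₆⟩ : WeierstrassCurve ℚ).baseChange ℚ_[p]).toAffine.Point //
      (3 : ℕ) • Q = 0} = 1 + 2 * S := by
  -- unpack the checker
  unfold threeTorsionCheckAt at h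
  split_ifs at h with hc
  simp only [Option.some.injEq] at h
  rw [Bool.and_eq_true, List.all_eq_true] at hc
  obtain ⟨hcheck, hg⟩ := hc
  subst h
  -- real-number facts about `p`
  have hp1 : (1 : ℝ) < p := by exact_mod_cast hp.out.one_lt
  have hp0 : (0 : ℝ) < p := by positivity
  have hpR : (p : ℝ) ≠ 0 := hp0.ne'
  -- the curve
  set E := Ep p a₁ a₂ a₃ a₄ a₆ with hEdef
  change Nat.card {Q : E.toAffine.Point // (3 : ℕ) • Q = 0} = _
  haveI : E.IsElliptic := by
    refine ⟨isUnit_iff_ne_zero.mpr ?_⟩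
    rw [hEdef, Ep_Δ]; exact_mod_cast hΔ
  have h2 : (2 : ℚ_[p]) ≠ 0 := two_ne_zero
  -- FILE A: the roots of `Ψ₃` in `ℤ_p`
  set l := psi3List a₁ a₂ a₃ a₄ a₆ with hl
  set lg := gList a₁ a₂ a₃ a₄ a₆ with hlg
  set rc := cert.map toRootEntry with hrc
  obtain ⟨ρ, hinj, hρ, hcomplete⟩ := exists_roots_of_check₂ (p := p) l k rc hcheck
  have hlen : rc.length = cert.length := by rw [hrc, List.length_map]
  have hget : ∀ i : Fin rc.length, rc.get i = toRootEntry (cert.get (Fin.cast hlen i)) := by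
    intro i; simp [hrc, List.getElem_map, Fin.cast]
  -- Step 1: torsion points ↔ (x, y) with `E(x,y)` and `Ψ₃(x) = 0`
  let S' := {xy : ℚ_[p] × ℚ_[p] // E.toAffine.Equation xy.1 xy.2 ∧ E.Ψ₃.eval xy.1 = 0}
  have e1 : {Q : E.toAffine.Point // (3 : ℕ) • Q = 0} ≃ WithZero S' := by
    refine (Affine.nonsingularPointEquivSubtype (p := fun Q => (3 : ℕ) • Q = 0)
      (show (3 : ℕ) • (0 : E.toAffine.Point) = 0 from nsmul_zero 3)).trans
      (Equiv.optionCongr (Equiv.subtypeEquivRight fun xy => ?_))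
    constructor
    · rintro ⟨hns, h3⟩
      exact ⟨hns.left, (three_nsmul_some_eq_zero_iff_eval_Ψ₃ E hns).mp h3⟩
    · rintro ⟨heq, hΨ⟩
      have hns : E.toAffine.Nonsingular xy.1 xy.2 := (Affine.equation_iff_nonsingular).mp heq
      exact ⟨hns, (three_nsmul_some_eq_zero_iff_eval_Ψ₃ E hns).mpr hΨ⟩
  -- Step 2: `S' ≃ Σ i, {y // E(ρ i, y)}` (FILE L2: the `x`-coordinates are integral)
  have hxint : ∀ s : S', ‖s.1.1‖ ≤ 1 := by
    rintro ⟨⟨x, y⟩, heq, hΨ⟩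
    exact norm_le_one_of_equation_of_eval_Ψ₃ E hp3 heq hΨ
  have hroot : ∀ s : S', ∃ i, ((ρ i : ℤ_[p]) : ℚ_[p]) = s.1.1 := by
    intro s
    set zs : ℤ_[p] := ⟨s.1.1, hxint s⟩ with hzs
    have hzs' : (zs : ℚ_[p]) = s.1.1 := rfl
    obtain ⟨i, hi⟩ := hcomplete zs (by
      have h1 := eval_Ψ₃_eq_aeval p a₁ a₂ a₃ a₄ a₆ zs
      rw [← hEdef, hzs'] at h1
      have : ((aeval zs (ofList l) : ℤ_[p]) : ℚ_[p]) = 0 := by rw [← h1]; exact s.2.2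
      exact PadicInt.coe_eq_zero.mp this)
    exact ⟨i, by rw [hi]⟩
  have hρroot : ∀ i, E.Ψ₃.eval ((ρ i : ℤ_[p]) : ℚ_[p]) = 0 := by
    intro i; rw [hEdef, eval_Ψ₃_eq_aeval, (hρ i).1]; rfl
  let F : Fin rc.length → Type :=
    fun i => {y : ℚ_[p] // E.toAffine.Equation ((ρ i : ℤ_[p]) : ℚ_[p]) y}
  have e2 : S' ≃ Σ i, F i :=
    { toFun := fun s => ⟨Classical.choose (hroot s), ⟨s.1.2, by
        rw [Classical.choose_spec (hroot s)]; exact s.2.1⟩⟩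
      invFun := fun s => ⟨(((ρ s.1 : ℤ_[p]) : ℚ_[p]), s.2.1), s.2.2, hρroot s.1⟩
      left_inv := by
        rintro ⟨⟨x, y⟩, heq, hΨ⟩
        have := Classical.choose_spec (hroot ⟨⟨x, y⟩, heq, hΨ⟩)
        apply Subtype.ext; apply Prod.ext
        · exact this
        · rfl
      right_inv := by
        rintro ⟨i, y, hy⟩
        have hspec := Classical.choose_spec (hroot ⟨(((ρ i : ℤ_[p]) : ℚ_[p]), y), hy, hρroot i⟩)
        have hi : Classical.choose (hroot ⟨(((ρ i : ℤ_[p]) : ℚ_[p]), y), hy, hρroot i⟩) = i :=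
          hinj (Subtype.ext hspec)
        exact Sigma.subtype_ext hi rfl }
  -- Step 3: per-index fibre counts from the square class of `g` (FILE L1)
  have hfib : ∀ i : Fin rc.length, Nat.card (F i) =
      if sqFlagAt p (evalList lg (cert.get (Fin.cast hlen i)).1) (cert.get (Fin.cast hlen i)).2.2.2
      then 2 else 0 := by
    intro i
    have hprec := (hρ i).2.2
    rw [hget i] at hprec
    simp only [toRootEntry] at hprec
    set e := cert.get (Fin.cast hlen i) with he
    obtain ⟨hw, hw', hN⟩ : (p : ℤ) ^ e.2.2.2 ∣ evalList lg e.1 ∧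
        ¬ (p : ℤ) ^ (e.2.2.2 + 1) ∣ evalList lg e.1 ∧ e.2.2.2 + sqPrecAt p + e.2.1 ≤ e.2.2.1 := by
      have := hg e (List.get_mem cert _)
      simp only [gEntryOKAt, Bool.and_eq_true, beq_iff_eq, Bool.not_eq_true', beq_eq_false_iff_ne,
        ne_eq, emod_eq_zero_iff_dvd', decide_eq_true_eq] at this
      exact ⟨this.1.1, this.1.2, this.2⟩
    set z := ρ i with hz
    set gc : ℤ := evalList lg e.1 with hgc
    have hgc0 : (gc : ℚ_[p]) ≠ 0 := by
      have : gc ≠ 0 := by rintro h0; rw [h0] at hw'; exact hw' (dvd_zero _)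
      exact_mod_cast this
    have hgcn : ‖(gc : ℚ_[p])‖ = (p : ℝ) ^ (-(e.2.2.2 : ℤ)) := norm_intCast_padic_eq hw hw'
    have hG := g_eq_aeval p a₁ a₂ a₃ a₄ a₆ z
    rw [← hEdef] at hG
    -- `‖g(z) - g(c)‖ ≤ ‖z - c‖ ≤ p^{-(N - m)} ≤ p^{-(w+δ)} = p^{-δ} ‖g(c)‖`
    have hdist : ‖((aeval z (ofList lg) : ℤ_[p]) : ℚ_[p]) - (gc : ℚ_[p])‖ ≤
        (p : ℝ) ^ (-(sqPrecAt p : ℤ)) * ‖(gc : ℚ_[p])‖ := by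
      have h1 := padic_polynomial_dist (ofList lg) z (e.1 : ℤ_[p])
      rw [aeval_intCast_ofList] at h1
      rw [hgcn, ← PadicInt.coe_intCast, ← PadicInt.coe_sub, ← PadicInt.norm_def]
      refine (h1.trans hprec).trans ?_
      rw [← zpow_add₀ hpR]
      have hmN : e.2.1 ≤ e.2.2.1 := by omega
      exact zpow_le_zpow_right₀ hp1.le (by push_cast [Nat.cast_sub hmN]; omega)
    obtain ⟨hG0, hGsq⟩ := isSquare_iff_of_norm_sub_le (one_le_sqPrecAt p)
      (fun h => sqPrecAt_eq_three_of_eq_two h) hgc0 hdist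
    have hsq := isSquare_intCast_padic_iff_sqFlagAt (p := p) gc e.2.2.2 hw hw'
    by_cases hflag : sqFlagAt p gc e.2.2.2 = true
    · rw [if_pos hflag]
      have : IsSquare (gc : ℚ_[p]) := hsq.mpr hflag
      refine natCard_fibre_eq_two E h2 _ ?_ ?_
      · rw [hG]; exact hGsq.mpr this
      · rw [hG]; exact hG0
    · rw [if_neg hflag]
      have : ¬ IsSquare (gc : ℚ_[p]) := fun hs => hflag (hsq.mp hs)
      refine natCard_fibre_eq_zero E h2 _ ?_
      rw [hG]; exact fun hs => this (hGsq.mp hs)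
  -- Step 4: count
  haveI : ∀ i, Finite (F i) := fun i => finite_fibre E h2 _
  haveI : Finite S' := Finite.of_equiv _ e2.symm
  haveI : Fintype S' := Fintype.ofFinite S'
  rw [Nat.card_congr e1, show Nat.card (WithZero S') = Nat.card (Option S') from rfl,
    Nat.card_eq_fintype_card, Fintype.card_option, ← Nat.card_eq_fintype_card, Nat.card_congr e2,
    Nat.card_sigma, add_comm]
  congr 1
  let f : ℤ × ℕ × ℕ × ℕ → ℕ := fun e => if sqFlagAt p (evalList lg e.1) e.2.2.2 then 2 else 0
  calc ∑ i, Nat.card (F i) = ∑ i : Fin rc.length, f (cert.get (Fin.cast hlen i)) :=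
        Finset.sum_congr rfl fun i _ => hfib i
    _ = ∑ i : Fin cert.length, f (cert.get i) :=
        Fintype.sum_equiv (finCongr hlen) _ _ (fun i => rfl)
    _ = (cert.map f).sum := sum_fin_eq_sum_map cert f
    _ = 2 * cert.countP (fun e => sqFlagAt p (evalList lg e.1) e.2.2.2) :=
        sum_map_ite_eq_two_mul_countP cert _

/-- Consumer shape `S = 0`: `#E(ℚ_p)[3] = 1` (the T-VIS3 `hloc` / free kind (i) numeral at a place
`v ∤ 3`, via p18's `ℚ_[p] ↔ v.adicCompletion ℚ` bridge). [folklore] -/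
theorem natCard_threeTorsion_padic_eq_one_of_check (hp3 : p ≠ 3)
    (hΔ : (⟨a₁, a₂, a₃, a₄, a₆⟩ : WeierstrassCurve ℤ).Δ ≠ 0) {k : ℕ}
    {cert : List (ℤ × ℕ × ℕ × ℕ)} (h : threeTorsionCheckAt p a₁ a₂ a₃ a₄ a₆ k cert = some 0) :
    Nat.card {Q : ((⟨a₁, a₂, a₃, a₄, a₆⟩ : WeierstrassCurve ℚ).baseChange ℚ_[p]).toAffine.Point //
      (3 : ℕ) • Q = 0} = 1 := by
  rw [natCard_threeTorsion_padic_eq_of_check p a₁ a₂ a₃ a₄ a₆ hp3 hΔ h]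

/-- Consumer shape `S = 1`: `#E(ℚ_p)[3] = 3` (so `≤ 3`: the free kind (ii) numeral of p04's
`sq_dvd_card_sha_three_of_congr_of_places` at a split multiplicative `w ≡ 1 (mod 3)`). [folklore] -/
theorem natCard_threeTorsion_padic_eq_three_of_check (hp3 : p ≠ 3)
    (hΔ : (⟨a₁, a₂, a₃, a₄, a₆⟩ : WeierstrassCurve ℤ).Δ ≠ 0) {k : ℕ}
    {cert : List (ℤ × ℕ × ℕ × ℕ)} (h : threeTorsionCheckAt p a₁ a₂ a₃ a₄ a₆ k cert = some 1) :
    Nat.card {Q : ((⟨a₁, a₂, a₃, a₄, a₆⟩ : WeierstrassCurve ℚ).baseChange ℚ_[p]).toAffine.Point //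
      (3 : ℕ) • Q = 0} = 3 := by
  rw [natCard_threeTorsion_padic_eq_of_check p a₁ a₂ a₃ a₄ a₆ hp3 hΔ h]

/-! ### Consumer shapes in route 1's `integralModelInt` currency -/

/-- If the globally minimal integer model of `W/ℚ` is `⟨a₁, …, a₆⟩` then `W` is that model read
in `ℚ`, and its integer discriminant is non-zero. -/
private theorem eq_and_Δ_ne_zero_of_intModel (W : WeierstrassCurve ℚ) [W.IsElliptic]
    [W.IsGloballyMinimal] (hI : W.integralModelInt = ⟨a₁, a₂, a₃, a₄, a₆⟩) :
    W = (⟨a₁, a₂, a₃, a₄, a₆⟩ : WeierstrassCurve ℚ) ∧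
      (⟨a₁, a₂, a₃, a₄, a₆⟩ : WeierstrassCurve ℤ).Δ ≠ 0 := by
  have hW := W.map_integralModelInt
  rw [hI] at hW
  refine ⟨by rw [← hW]; ext <;> simp [WeierstrassCurve.map], fun h0 => ?_⟩
  have hΔ : W.Δ = (((⟨a₁, a₂, a₃, a₄, a₆⟩ : WeierstrassCurve ℤ).Δ : ℤ) : ℚ) := by
    rw [← hW, WeierstrassCurve.map_Δ]; simp
  rw [h0, Int.cast_zero] at hΔ
  exact W.isUnit_Δ.ne_zero hΔ

/-- **THE DECIDER, `integralModelInt` currency**: for `W/ℚ` globally minimal with integer model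
`⟨a₁, …, a₆⟩` and a prime `p ≠ 3`, `threeTorsionCheckAt p a₁ … a₆ k cert = some S` gives
`#E(ℚ_p)[3] = 1 + 2S`. [folklore] -/
theorem natCard_threeTorsion_padic_eq_of_intModel_of_check (hp3 : p ≠ 3) (W : WeierstrassCurve ℚ)
    [W.IsElliptic] [W.IsGloballyMinimal] (hI : W.integralModelInt = ⟨a₁, a₂, a₃, a₄, a₆⟩) {k S : ℕ}
    {cert : List (ℤ × ℕ × ℕ × ℕ)} (h : threeTorsionCheckAt p a₁ a₂ a₃ a₄ a₆ k cert = some S) :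
    Nat.card {Q : (W.baseChange ℚ_[p]).toAffine.Point // (3 : ℕ) • Q = 0} = 1 + 2 * S := by
  obtain ⟨hW, hΔ⟩ := eq_and_Δ_ne_zero_of_intModel a₁ a₂ a₃ a₄ a₆ W hI
  rw [hW]
  exact natCard_threeTorsion_padic_eq_of_check p a₁ a₂ a₃ a₄ a₆ hp3 hΔ h

/-- `integralModelInt` currency, `S = 0`: `#E(ℚ_p)[3] = 1`. [folklore] -/
theorem natCard_threeTorsion_padic_eq_one_of_intModel_of_check (hp3 : p ≠ 3)
    (W : WeierstrassCurve ℚ) [W.IsElliptic] [W.IsGloballyMinimal]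
    (hI : W.integralModelInt = ⟨a₁, a₂, a₃, a₄, a₆⟩) {k : ℕ} {cert : List (ℤ × ℕ × ℕ × ℕ)}
    (h : threeTorsionCheckAt p a₁ a₂ a₃ a₄ a₆ k cert = some 0) :
    Nat.card {Q : (W.baseChange ℚ_[p]).toAffine.Point // (3 : ℕ) • Q = 0} = 1 := by
  rw [natCard_threeTorsion_padic_eq_of_intModel_of_check p a₁ a₂ a₃ a₄ a₆ hp3 W hI h]

/-- `integralModelInt` currency, `S = 1`: `#E(ℚ_p)[3] = 3`. [folklore] -/
theorem natCard_threeTorsion_padic_eq_three_of_intModel_of_check (hp3 : p ≠ 3)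
    (W : WeierstrassCurve ℚ) [W.IsElliptic] [W.IsGloballyMinimal]
    (hI : W.integralModelInt = ⟨a₁, a₂, a₃, a₄, a₆⟩) {k : ℕ} {cert : List (ℤ × ℕ × ℕ × ℕ)}
    (h : threeTorsionCheckAt p a₁ a₂ a₃ a₄ a₆ k cert = some 1) :
    Nat.card {Q : (W.baseChange ℚ_[p]).toAffine.Point // (3 : ℕ) • Q = 0} = 3 := by
  rw [natCard_threeTorsion_padic_eq_of_intModel_of_check p a₁ a₂ a₃ a₄ a₆ hp3 W hI h]

end Main

end Summit.BirchSwinnertonDyer.Rank1Residual.GaloisImage.LocalTorsion3At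

end
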